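import Mathlib
import Literature.NumberTheory.Sieve.LevelOfDistribution
import Literature.NumberTheory.Sieve.BombieriAsymptoticSieve
import Literature.NumberTheory.Sieve.TwistedVonMangoldtModSix

/-!
# The odd-restricted shifted convolution `1_{m odd}(Λ ⋆ Λ)(m+2)` violates Bombieri's `(A₂)`

A fully proved negative result about Bombieri's sieve axioms (`SieveSequence.BombieriA2`,
`Literature/NumberTheory/Sieve/BombieriAsymptoticSieve.lean`, [BombieriRIMS1977] p. 3 (A₂)): the sifted
sequence `a_m = 1_{m odd} ∑_{cd = m+2} Λ(c)Λ(d)` with Bombieri's counting function `A(x) = ∑_{m ≤ x} a_m` as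
`size` and the shifted-primes density `g(d) = 1_{(d,2)=1}/φ(d)` (`shiftedPrimesDensity 2`) does NOT satisfy
`(A₂)` (level `x^{1−ε}` with saving `(log x)^{−B}` for every `B`): `cmSeq_not_bombieriA2`.

Reason: the multiplicative model `g(3) = 1/2` presumes no `Λ ⋆ Λ`-mass on multiples of `3`, but the pairs
`(3, p)`, `(p, 3)` give the odd multiples of `3` the mass `≍ x` (a `1/log x`-proportion of `A(x) ≍ x log x`), so
`R(x; 3) = A(x;3) − A(x)/2 ≤ −x/10` for large `x` (`remainder_three_large`), while `(A₂)` with `ε = 1/2`, `B = 2`,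
`y_d = x` forces `|R(x;3)| ≤ 5C·x/log x`. Inputs: `TwistedVonMangoldtModSix` (Selberg-formula size bound,
Siegel–Walfisz mod `6` + hyperbola method for the `χ₆`-twisted part, Chebyshev `θ`-lower bound for the odd
multiples of `3`). The same bias `−2x log p/(p−1)²` occurs at every odd prime `p`.

Used by the parity-summit refutation
`Summits/Parity/GeneralizedHardyLittlewood/Theorems/PrimeDeterminantCellsConvMomentLevelOneRefutation.lean`
(route review rreview-0815T14-0, item stmt-Parity-9541): the route's hypothesis `ConvMomentLevelOne` asserts
`(A₂)` for exactly this sequence at `i = j = 0` (`cmSeq_hyp` is its sequence clause, token for token).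
Nothing here is new mathematics. [folklore]
-/

noncomputable section

open Finset Filter
open scoped ArithmeticFunction.vonMangoldt Chebyshev
open Literature.NumberTheory.Sieve.TwistedModSix

namespace Literature.NumberTheory.Sieve

namespace OddShiftedConv

/-! ### The sequence -/

/-- The sequence `a_m = 1_{m odd} (Λ ⋆ Λ)(m + 2)`, written token for token as in the `i = j = 0` case of the parity route's hypothesis `ConvMomentLevelOne` (log-power weights `^ 0` kept on purpose). [folklore] -/
def cmA (m : ℕ) : ℝ :=
  if m % 2 = 1 then ∑ cd ∈ Nat.divisorsAntidiagonal (m + 2),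
    Λ cd.1 * Real.log cd.1 ^ (0:ℕ) * (Λ cd.2 * Real.log cd.2 ^ (0:ℕ)) else 0

/-- `a_m = 1_{m odd} (Λ ⋆ Λ)(m+2)` as a Dirichlet convolution. [folklore] -/
theorem cmA_eq (m : ℕ) : cmA m = if m % 2 = 1 then (Λ * Λ) (m + 2) else 0 := by
  unfold cmA
  split_ifs with h
  · rw [ArithmeticFunction.mul_apply]
    refine Finset.sum_congr rfl fun cd _ => ?_
    simp
  · rfl

/-- `a_m ≥ 0`. [folklore] -/
theorem cmA_nonneg (m : ℕ) : 0 ≤ cmA m := by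
  rw [cmA_eq]
  split_ifs
  · exact vonMangoldt_conv_nonneg _
  · exact le_rfl

/-- `a_m ≤ (Λ ⋆ Λ)(m+2)`. [folklore] -/
theorem cmA_le_conv (m : ℕ) : cmA m ≤ (Λ * Λ) (m + 2) := by
  rw [cmA_eq]
  split_ifs
  · exact le_rfl
  · exact vonMangoldt_conv_nonneg _

/-- Preliminary bundling of the sequence (the `size` field is irrelevant here). [folklore] -/
def cmSeq₀ : Literature.NumberTheory.Sieve.SieveSequence where
  a := cmA
  a_nonneg := cmA_nonneg
  size := fun _ => 0
  density := Literature.NumberTheory.Sieve.shiftedPrimesDensity 2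
  density_mult := Literature.NumberTheory.Sieve.isMultiplicative_shiftedPrimesDensity 2

/-- The sifted sequence `1_{m odd}(Λ ⋆ Λ)(m+2)` with Bombieri's counting function as `size` and density `1_{(d,2)=1}/φ(d)`. [folklore] -/
def cmSeq : Literature.NumberTheory.Sieve.SieveSequence :=
  { cmSeq₀ with size := fun x => cmSeq₀.congrSum 1 x }

/-- Unfolding of the sequence field. [folklore] -/
theorem cmSeq_a (m : ℕ) : cmSeq.a m = cmA m := rfl

/-- `size = A(x) = ∑_{m ≤ x} a_m` (definitional). [folklore] -/
theorem cmSeq_size (x : ℝ) : cmSeq.size x = cmSeq.congrSum 1 x := rfl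

/-- The density is `shiftedPrimesDensity 2` (definitional). [folklore] -/
theorem cmSeq_density : cmSeq.density = Literature.NumberTheory.Sieve.shiftedPrimesDensity 2 := rfl

/-- The sequence clause of the parity route's `ConvMomentLevelOne` at `i = j = 0` holds for `cmSeq` definitionally. [folklore] -/
theorem cmSeq_hyp (m : ℕ) : cmSeq.a m = if m % 2 = 1 then ∑ cd ∈ Nat.divisorsAntidiagonal (m + 2),
    ArithmeticFunction.vonMangoldt cd.1 * Real.log cd.1 ^ (0:ℕ) *
      (ArithmeticFunction.vonMangoldt cd.2 * Real.log cd.2 ^ (0:ℕ)) else 0 := rfl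

/-- `A(x) = ∑_{0 < n ≤ ⌊x⌋} a_n`. [folklore] -/
theorem cmSeq_size_eq (x : ℝ) : cmSeq.size x = ∑ n ∈ Ioc 0 ⌊x⌋₊, cmA n := by
  rw [cmSeq_size, Literature.NumberTheory.Sieve.SieveSequence.congrSum,
    Finset.filter_true_of_mem (fun n _ => one_dvd n)]
  rfl

/-- `A(x; 3) = ∑_{0 < n ≤ ⌊x⌋, 3 ∣ n} a_n`. [folklore] -/
theorem cmSeq_congrSum_three (x : ℝ) :
    cmSeq.congrSum 3 x = ∑ n ∈ (Ioc 0 ⌊x⌋₊).filter (3 ∣ ·), cmA n := rfl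

/-- `g(3) = 1/φ(3) = 1/2`. [folklore] -/
theorem cmSeq_density_three : cmSeq.density 3 = 1 / 2 := by
  rw [cmSeq_density, Literature.NumberTheory.Sieve.shiftedPrimesDensity_apply]
  rw [if_pos ⟨by norm_num, by norm_num⟩, Nat.totient_prime Nat.prime_three]
  norm_num

/-- `R(x; 3) = A(x; 3) − A(x)/2`. [folklore] -/
theorem cmSeq_remainder_three (x : ℝ) :
    cmSeq.remainder 3 x = cmSeq.congrSum 3 x - cmSeq.size x / 2 := by
  rw [Literature.NumberTheory.Sieve.SieveSequence.remainder, cmSeq_density_three]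
  ring

/-- `A(x) ≥ 0`. [folklore] -/
theorem size_nonneg (x : ℝ) : 0 ≤ cmSeq.size x := by
  rw [cmSeq_size_eq]
  exact Finset.sum_nonneg fun n _ => cmA_nonneg n

/-! ### Size bound via Selberg's formula -/

/-- `A(x) ≤ ∑_{k ≤ ⌊x⌋+2} (Λ ⋆ Λ)(k)`. [folklore] -/
theorem size_le_sum_conv (x : ℝ) : cmSeq.size x ≤ ∑ k ∈ Ioc 0 (⌊x⌋₊ + 2), (Λ * Λ) k := by
  rw [cmSeq_size_eq]
  have hre : ∑ n ∈ Ioc 0 ⌊x⌋₊, (Λ * Λ) (n + 2) = ∑ k ∈ Ioc 2 (⌊x⌋₊ + 2), (Λ * Λ) k := by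
    have := Finset.sum_map (Ioc 0 ⌊x⌋₊) (addRightEmbedding 2) (fun k => (Λ * Λ) k)
    rw [Finset.map_add_right_Ioc, zero_add] at this
    rw [this]; rfl
  calc ∑ n ∈ Ioc 0 ⌊x⌋₊, cmA n
      ≤ ∑ n ∈ Ioc 0 ⌊x⌋₊, (Λ * Λ) (n + 2) := Finset.sum_le_sum fun n _ => cmA_le_conv n
    _ = ∑ k ∈ Ioc 2 (⌊x⌋₊ + 2), (Λ * Λ) k := hre
    _ ≤ ∑ k ∈ Ioc 0 (⌊x⌋₊ + 2), (Λ * Λ) k :=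
        Finset.sum_le_sum_of_subset_of_nonneg (Finset.Ioc_subset_Ioc_left (by norm_num))
          fun k _ _ => vonMangoldt_conv_nonneg k

/-- `A(x) ≤ 5 x log x` for large `x`. [folklore] -/
theorem size_le : ∀ᶠ x : ℝ in atTop, cmSeq.size x ≤ 5 * x * Real.log x := by
  filter_upwards [eventually_ge_atTop (Real.exp 344)] with x hx
  have hx1 : (345:ℝ) ≤ x := le_trans (by linarith [Real.add_one_le_exp (344:ℝ)]) hx
  have hxpos : 0 < x := by linarith
  have hlogx : (344:ℝ) ≤ Real.log x := by
    rw [Real.le_log_iff_exp_le hxpos]; exact hx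
  set K : ℕ := ⌊x⌋₊ + 2 with hK
  have hKx : (K:ℝ) ≤ 2 * x := by
    rw [hK]; push_cast
    linarith [Nat.floor_le hxpos.le]
  have hK1 : (1:ℝ) ≤ K := by rw [hK]; push_cast; linarith
  have hKpos : (0:ℝ) < K := by linarith
  have hlogK : Real.log K ≤ 1 + Real.log x := by
    calc Real.log K ≤ Real.log (2 * x) := Real.log_le_log hKpos hKx
      _ = Real.log 2 + Real.log x := Real.log_mul (by norm_num) hxpos.ne'
      _ ≤ 1 + Real.log x := by linarith [Real.log_two_lt_d9]
  have hlogK0 : 0 ≤ Real.log K := Real.log_nonneg hK1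
  calc cmSeq.size x ≤ ∑ k ∈ Ioc 0 K, (Λ * Λ) k := size_le_sum_conv x
    _ ≤ 2 * K * Real.log K + 170 * K := sum_vonMangoldt_conv_le K
    _ ≤ 2 * (2 * x) * (1 + Real.log x) + 170 * (2 * x) := by
        gcongr
    _ = 4 * x * Real.log x + 344 * x := by ring
    _ ≤ 5 * x * Real.log x := by nlinarith

/-! ### Decomposition of `size − 2·congrSum 3` -/

/-- `a_n · (−1)^{[3 ∣ n]} = t₀(n+2) + (twist ⋆ twist)(n+2)` (six residue cases mod `6`). [folklore] -/
theorem term_identity (n : ℕ) :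
    cmA n * (if 3 ∣ n then -1 else 1) = oddMultThree (n + 2) + (twist * twist) (n + 2) := by
  rw [cmA_eq, twist_mul_twist_apply]
  unfold oddMultThree chi6
  split_ifs <;> first | (exfalso; omega) | ring

/-- Reindexing `n ↦ n + 2`. [folklore] -/
theorem sum_shift_two (g : ℕ → ℝ) (N : ℕ) :
    ∑ n ∈ Ioc 0 N, g (n + 2) = ∑ k ∈ Ioc 2 (N + 2), g k := by
  have := Finset.sum_map (Ioc 0 N) (addRightEmbedding 2) g
  rw [Finset.map_add_right_Ioc, zero_add] at this
  rw [this]; rfl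

/-- `A(x) − 2A(x;3) = T₀ + T₁`. [folklore] -/
theorem size_sub_two_congrSum (x : ℝ) :
    cmSeq.size x - 2 * cmSeq.congrSum 3 x =
      ∑ k ∈ Ioc 2 (⌊x⌋₊ + 2), oddMultThree k + ∑ k ∈ Ioc 2 (⌊x⌋₊ + 2), (twist * twist) k := by
  rw [cmSeq_size_eq, cmSeq_congrSum_three]
  set N := ⌊x⌋₊
  have hsplit := Finset.sum_filter_add_sum_filter_not (Ioc 0 N) (fun n => 3 ∣ n) cmA
  have hsplit' := Finset.sum_filter_add_sum_filter_not (Ioc 0 N) (fun n => 3 ∣ n)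
    (fun n => cmA n * (if 3 ∣ n then -1 else 1))
  have h1 : ∑ n ∈ (Ioc 0 N).filter (fun n => 3 ∣ n), cmA n * (if 3 ∣ n then -1 else 1) =
      - ∑ n ∈ (Ioc 0 N).filter (fun n => 3 ∣ n), cmA n := by
    rw [← Finset.sum_neg_distrib]
    refine Finset.sum_congr rfl fun n hn => ?_
    rw [if_pos (Finset.mem_filter.1 hn).2]; ring
  have h2 : ∑ n ∈ (Ioc 0 N).filter (fun n => ¬ 3 ∣ n), cmA n * (if 3 ∣ n then -1 else 1) =
      ∑ n ∈ (Ioc 0 N).filter (fun n => ¬ 3 ∣ n), cmA n := by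
    refine Finset.sum_congr rfl fun n hn => ?_
    rw [if_neg (Finset.mem_filter.1 hn).2]; ring
  have hmain : ∑ n ∈ Ioc 0 N, cmA n - 2 * ∑ n ∈ (Ioc 0 N).filter (fun n => 3 ∣ n), cmA n =
      ∑ n ∈ Ioc 0 N, cmA n * (if 3 ∣ n then -1 else 1) := by
    linarith
  rw [hmain, ← sum_shift_two, ← sum_shift_two, ← Finset.sum_add_distrib]
  exact Finset.sum_congr rfl fun n _ => term_identity n

/-- `|R(x; 3)| ≥ x/10` for large `x`. [folklore] -/
theorem remainder_three_large : ∀ᶠ x : ℝ in atTop, x / 10 ≤ |cmSeq.remainder 3 x| := by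
  filter_upwards [oddMultThree_sum_eventually, twist_conv_sum_eventually, eventually_ge_atTop (0:ℝ)] with x h0 h1 hx0
  rw [cmSeq_remainder_three]
  have hid := size_sub_two_congrSum x
  have h1' := neg_abs_le (∑ k ∈ Ioc 2 (⌊x⌋₊ + 2), (twist * twist) k)
  rw [abs_sub_comm, abs_of_nonneg (by linarith)]
  linarith

/-- **The sequence `1_{m odd}(Λ ⋆ Λ)(m+2)` with density `1_{(d,2)=1}/φ(d)` violates Bombieri's `(A₂)`**:
witness `ε = 1/2`, `B = 2`, `y_d = x`, the single modulus `d = 3` (`|R(x;3)| ≥ x/10` eventually, while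
`(A₂)` and `A(x) ≤ 5x log x` give `|R(x;3)| ≤ 5C·x/log x`). [folklore] -/
theorem cmSeq_not_bombieriA2 : ¬ cmSeq.BombieriA2 := by
  intro hA2
  obtain ⟨C, hC⟩ := hA2 (1/2) (by norm_num) 2 (by norm_num)
  have h3 : ∀ᶠ x : ℝ in atTop, |cmSeq.remainder 3 x| ≤ C * cmSeq.size x / Real.log x ^ (2:ℝ) := by
    filter_upwards [hC, eventually_ge_atTop (16:ℝ)] with x hx hx16
    have hsum := hx (fun _ => x) (fun _ => le_rfl)
    refine le_trans ?_ hsum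
    have hmem : (3:ℕ) ∈ Finset.Ico 1 ⌈x ^ (1 - 1/2 : ℝ)⌉₊ := by
      rw [Finset.mem_Ico]
      refine ⟨by norm_num, ?_⟩
      have hx4 : (4:ℝ) ≤ x ^ (1 - 1/2 : ℝ) := by
        rw [show (1 - 1/2 : ℝ) = 1/2 by norm_num, ← Real.sqrt_eq_rpow]
        rw [show (4:ℝ) = Real.sqrt 16 by
          rw [show (16:ℝ) = 4^2 by norm_num, Real.sqrt_sq (by norm_num)]]
        exact Real.sqrt_le_sqrt hx16
      have : (3:ℕ) < ⌈x ^ (1 - 1/2 : ℝ)⌉₊ := by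
        rw [Nat.lt_ceil]; push_cast; linarith
      exact this
    exact Finset.single_le_sum (f := fun d => |cmSeq.remainder d x|) (fun d _ => abs_nonneg _) hmem
  have hev := (remainder_three_large.and (size_le.and h3)).and
    (eventually_gt_atTop (Real.exp (50 * |C| + 50)))
  obtain ⟨x, ⟨hR, hS, hB⟩, hx⟩ := hev.exists
  have hx1 : (1:ℝ) < x := by
    have h1 := Real.add_one_lt_exp (by positivity : (50 * |C| + 50 : ℝ) ≠ 0)
    have h2 : (0:ℝ) ≤ 50 * |C| := by positivity
    linarith
  have hxpos : 0 < x := by linarith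
  have hlog : 50 * |C| + 50 < Real.log x := by
    rw [Real.lt_log_iff_exp_lt hxpos]; exact hx
  have hlogpos : 0 < Real.log x := by linarith [abs_nonneg C]
  have key : x / 10 ≤ 5 * |C| * x / Real.log x := by
    calc x / 10 ≤ |cmSeq.remainder 3 x| := hR
      _ ≤ C * cmSeq.size x / Real.log x ^ (2:ℝ) := hB
      _ ≤ |C| * (5 * x * Real.log x) / Real.log x ^ (2:ℝ) := by
          apply div_le_div_of_nonneg_right _ (by positivity)
          calc C * cmSeq.size x ≤ |C| * cmSeq.size x :=
                mul_le_mul_of_nonneg_right (le_abs_self C) (size_nonneg x)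
            _ ≤ |C| * (5 * x * Real.log x) := mul_le_mul_of_nonneg_left hS (abs_nonneg C)
      _ = 5 * |C| * x / Real.log x := by
          rw [Real.rpow_two]; field_simp
  have : Real.log x ≤ 50 * |C| := by
    rw [div_le_div_iff₀ (by norm_num) hlogpos] at key
    nlinarith [abs_nonneg C]
  linarith

end OddShiftedConv

end Literature.NumberTheory.Sieve

end
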